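import Literature.AlgebraicGeometry.AbelianSchemes.IsogenyKernelReduction
import Literature.AlgebraicGeometry.AbelianSchemes.IsogenyOfGenericIsogenyRank
import Literature.AlgebraicGeometry.GroupSchemes.ReductionSurjectiveOfCardSections
import Mathlib.RingTheory.Spectrum.Prime.FreeLocus
import HarnessLib

/-!
# If all `deg φ_K` points of the kernel of a generic isogeny are rational, the reduction map on its sections is SURJECTIVE
# ([SerreTate1968] §1 Lemma 1; [BoschLutkebohmertRaynaud1990] §7.3 Prop. 6 (p. 180); [StacksProject] Tag 04GG)

Topic `Literature/AlgebraicGeometry/AbelianSchemes`, namespace `Literature.AlgebraicGeometry.AbelianSchemes.AbelianSchemeOver`.  THEOREMS ONLY (no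
definition, no named fact, no instance, no notation, no `sorry`).  The composite head **(o-c2l′)** of the P6c desk (F0P6c-plan (g0) 14:43:33Z; cell
`pub/hodgecm-mathlib`, P6 «MOD», door P″, letters DICT (c2) `red_translΩ` ∕ (b4′) `canonicalLine`): `R` a HENSELIAN Dedekind domain (the complete DVR
`𝒪_L` of record) with fraction field `K`, `φ : A → B` a homomorphism of abelian schemes over `Spec R` whose generic fibre is an isogeny, `G := Ker φ` (★
`GroupSchemeKernel.ker φ`; finite flat of rank `deg φ_K = kerRank φ_K` over `Spec R` by ★ (o-c2f)∕(o-c2f′)∕(o-c2l)).  IF all `kerRank φ_K` points of `G_K` are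
`K`-rational — `Nat.card {t : Spec K → G over Spec R} = kerRank φ_K` — THEN the reduction map `G(R) → G(k)` is SURJECTIVE for every field `k` over
`κ(R)`: every `k`-point of `G` over `Spec (ψ ∘ residue)` is the reduction of a section (★ `ReductionSurjectiveOfCardSections.exists_section_comp_eq_of_card_sections_eq_finrank`,
whose hypothesis `#sections = rank` is supplied by `G(K) = G(R)` ★ `existsUnique_section_ker_comp_eq` and `rank = kerRank φ_K` ★
`finrank_fst_unit_eq_kerRank_genericFibre`).  A coordinate-ring presentation `eB : G ≅ Spec B` over `Spec R` is taken as a binder (★ p844935's shape;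
`G` is affine).  Generic capital `--supports stmt-HodgeConjecture-24832`.  HONEST LABEL: HC_CM is proved only modulo the cell's 2 remaining named inputs
(hLiu418 24832, h413 24833) until rung 0 closes; this file pays no letter.

* `finrank_ker_hom_eq_kerRank` — `finrank (Ker φ → Spec R) s = kerRank φ_K` at every `s` (★ (o-c2f′) through ★ `isPullback_kerι_left`);
* `finrank_presentation_eq_kerRank` — `Module.finrank R B = kerRank φ_K` for any presentation `eB` (Mathlib `finrank_SpecMap_algebraMap`,
  `Module.rankAtStalk_eq_finrank_of_free`; `B` is finite flat, hence free, over the local `R`);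
* `natCard_sections_ker_eq_natCard_points` — `#G(R) = #G(K)` (★ `existsUnique_section_ker_comp_eq`);
* **`exists_section_ker_reduction_eq_of_card_points`** — the head.

## References
* [SerreTate1968] J.-P. Serre, J. Tate, *Good reduction of abelian varieties*, Ann. of Math. 88 (1968), §1 Lemma 1.
* [BoschLutkebohmertRaynaud1990] S. Bosch, W. Lütkebohmert, M. Raynaud, *Néron Models* (1990), §7.3 Prop. 6 (p. 180).
* [StacksProject] The Stacks Project, Tag 04GG (finite algebras over henselian local rings), Tag 02KA (rank of finite locally free morphisms).
-/

set_option autoImplicit false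

noncomputable section

universe u

open CategoryTheory CategoryTheory.Limits AlgebraicGeometry IsLocalRing MonoidalCategory CartesianMonoidalCategory
open scoped MonObj
open Literature.NumberTheory.EllipticCurves (specGenericPoint)
open Literature.AlgebraicGeometry.Motives (AbelianVariety)
open Literature.AlgebraicGeometry.GroupSchemes

namespace Literature.AlgebraicGeometry.AbelianSchemes

namespace AbelianSchemeOver

variable {R : Type u} [CommRing R] [IsDedekindDomain R] (K : Type u) [Field K] [Algebra R K] [IsFractionRing R K]
  {A B : AbelianSchemeOver (Spec (CommRingCat.of R))} (φ : A.X ⟶ B.X) [IsMonHom φ]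

/-! ### §1 Ranks: `finrank (Ker φ → Spec R) = kerRank φ_K = finrank_R B` -/

/-- **`finrank (Ker φ → Spec R) s = kerRank φ_K`** at every point `s` of `Spec R` (★ `finrank_fst_unit_eq_kerRank_genericFibre` transported along the cartesian
square ★ `GroupSchemeKernel.isPullback_kerι_left`, Mathlib `Scheme.Hom.finrank_of_isPullback`). [cite: StacksProject, Tag 02KA]
[cite: BoschLutkebohmertRaynaud1990, §7.3 Prop. 6 (p. 180)] -/
theorem finrank_ker_hom_eq_kerRank (hφ : AbelianVariety.IsIsogeny (fibreHom φ (specGenericPoint R K))) (s : ↥(Spec (CommRingCat.of R))) :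
    Scheme.Hom.finrank (GroupSchemeKernel.ker φ).hom s = AbelianVariety.Hom.kerRank (fibreHom φ (specGenericPoint R K)) := by
  have hiso : ∀ ⦃Ω : Type u⦄ [Field Ω] [IsAlgClosed Ω] (t : Spec (.of Ω) ⟶ Spec (.of R)), AbelianVariety.IsIsogeny (fibreHom φ t) :=
    fun _ _ _ t => isIsogeny_fibreHom_of_isIsogeny_genericFibre K φ hφ t
  haveI := isFinite_left_of_isIsogeny_fibreHom φ hiso
  haveI := flat_left_of_isIsogeny_fibreHom φ hiso
  rw [ker_hom_eq]
  have h1 := Scheme.Hom.finrank_of_isPullback _ _ _ _ (GroupSchemeKernel.isPullback_kerι_left φ) s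
  have h2 := Scheme.Hom.finrank_pullback_fst φ.left (η[B.X] : 𝟙_ _ ⟶ B.X).left s
  have h3 := finrank_fst_unit_eq_kerRank_genericFibre K φ hφ s
  exact h1.trans (h2.symm.trans h3)

/-- **`Module.finrank R B = kerRank φ_K`** for any presentation `eB : Ker φ ≅ Spec B` over `Spec R` with `R` local: `B` is finite flat (★ `finite_of_iso_Spec`,
`flat_of_iso_Spec`), hence free, and the rank of `Spec B → Spec R` at the closed point is `finrank_R B` (Mathlib `finrank_SpecMap_algebraMap`,
`Module.rankAtStalk_eq_finrank_of_free`). [cite: StacksProject, Tag 02KA] [cite: BoschLutkebohmertRaynaud1990, §7.3 Prop. 6 (p. 180)] -/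
theorem finrank_presentation_eq_kerRank [IsLocalRing R] (hφ : AbelianVariety.IsIsogeny (fibreHom φ (specGenericPoint R K)))
    (B' : Type u) [CommRing B'] [Algebra R B'] (eB : (GroupSchemeKernel.ker φ).left ≅ Spec (CommRingCat.of B'))
    (heB : eB.hom ≫ Spec.map (CommRingCat.ofHom (algebraMap R B')) = (GroupSchemeKernel.ker φ).hom) :
    Module.finrank R B' = AbelianVariety.Hom.kerRank (fibreHom φ (specGenericPoint R K)) := by
  haveI := isFinite_ker_hom K φ hφ
  haveI := flat_ker_hom K φ hφ
  haveI : Module.Finite R B' := finite_of_iso_Spec (GroupSchemeKernel.ker φ) B' eB heB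
  haveI : Module.Flat R B' := flat_of_iso_Spec (GroupSchemeKernel.ker φ) B' eB heB
  haveI : Module.Free R B' := Module.free_of_flat_of_isLocalRing
  have h1 := Scheme.Hom.finrank_SpecMap_algebraMap R B' (closedPoint R)
  rw [Module.rankAtStalk_eq_finrank_of_free, specMap_algebraMap_eq_inv_comp (GroupSchemeKernel.ker φ) B' eB heB,
    Scheme.Hom.finrank_comp_left_of_isIso] at h1
  rw [← finrank_ker_hom_eq_kerRank K φ hφ (closedPoint R)]
  exact h1.symm

/-! ### §2 `#G(R) = #G(K)` -/

/-- **`#(Ker φ)(R) = #(Ker φ)(K)`**: sections of `Ker φ` over `Spec R` are in bijection with its `K`-points over `Spec R` (★ `existsUnique_section_ker_comp_eq`: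
`R` integrally closed, `Ker φ` finite). [cite: SerreTate1968, §1 Lemma 1] -/
theorem natCard_sections_ker_eq_natCard_points (hφ : AbelianVariety.IsIsogeny (fibreHom φ (specGenericPoint R K))) :
    Nat.card (𝟙_ (Over (Spec (CommRingCat.of R))) ⟶ GroupSchemeKernel.ker φ) =
      Nat.card {t : Spec (CommRingCat.of K) ⟶ (GroupSchemeKernel.ker φ).left //
        t ≫ (GroupSchemeKernel.ker φ).hom = Spec.map (CommRingCat.ofHom (algebraMap R K))} := by
  have hw : ∀ s : 𝟙_ (Over (Spec (CommRingCat.of R))) ⟶ GroupSchemeKernel.ker φ,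
      (Spec.map (CommRingCat.ofHom (algebraMap R K)) ≫ s.left) ≫ (GroupSchemeKernel.ker φ).hom =
        Spec.map (CommRingCat.ofHom (algebraMap R K)) := fun s =>
    (Category.assoc _ _ _).trans
      ((congrArg (Spec.map (CommRingCat.ofHom (algebraMap R K)) ≫ ·) (Over.w s)).trans (Category.comp_id _))
  refine Nat.card_congr (Equiv.ofBijective
    (fun s => ⟨Spec.map (CommRingCat.ofHom (algebraMap R K)) ≫ s.left, hw s⟩) ⟨fun s s' h => ?_, fun t => ?_⟩)
  · have h' : Spec.map (CommRingCat.ofHom (algebraMap R K)) ≫ s.left = Spec.map (CommRingCat.ofHom (algebraMap R K)) ≫ s'.left :=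
      congrArg Subtype.val h
    obtain ⟨s₀, -, huniq⟩ := existsUnique_section_ker_comp_eq K φ hφ _ (hw s')
    exact (huniq s h').trans (huniq s' rfl).symm
  · obtain ⟨s, hs, -⟩ := existsUnique_section_ker_comp_eq K φ hφ t.1 t.2
    exact ⟨s, Subtype.ext hs⟩

/-! ### §3 The head: surjectivity of the reduction on `Ker φ` when all points are rational -/

/-- **REDUCTION ON THE KERNEL OF A GENERIC ISOGENY IS SURJECTIVE WHEN ALL ITS POINTS ARE RATIONAL.**  `R` a henselian Dedekind domain (e.g. the complete
DVR `𝒪_L`), `K = Frac R`, `φ : A → B` a generic isogeny of abelian schemes over `Spec R`, `eB : Ker φ ≅ Spec B` a presentation over `Spec R`.  If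
`#{t : Spec K → Ker φ over Spec R} = kerRank φ_K` (all `deg φ_K` geometric points of `(Ker φ)_K` are `K`-rational), then for every field `k`, every
`ψ : κ(R) → k` and every `k`-point `t₀` of `Ker φ` over `Spec (ψ ∘ residue)` there is a SECTION `s ∈ (Ker φ)(R)` reducing to `t₀`.  Assembly: `#sections = #K-points`
(§2) `= kerRank φ_K = finrank_R B` (§1), then ★ `ReductionSurjectiveOfCardSections.exists_section_comp_eq_of_card_sections_eq_finrank`.
[cite: SerreTate1968, §1 Lemma 1] [cite: StacksProject, Tag 04GG] [cite: BoschLutkebohmertRaynaud1990, §7.3 Prop. 6 (p. 180)] -/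
theorem exists_section_ker_reduction_eq_of_card_points [HenselianLocalRing R]
    (hφ : AbelianVariety.IsIsogeny (fibreHom φ (specGenericPoint R K)))
    (B' : Type u) [CommRing B'] [Algebra R B'] (eB : (GroupSchemeKernel.ker φ).left ≅ Spec (CommRingCat.of B'))
    (heB : eB.hom ≫ Spec.map (CommRingCat.ofHom (algebraMap R B')) = (GroupSchemeKernel.ker φ).hom)
    (hK : Nat.card {t : Spec (CommRingCat.of K) ⟶ (GroupSchemeKernel.ker φ).left //
        t ≫ (GroupSchemeKernel.ker φ).hom = Spec.map (CommRingCat.ofHom (algebraMap R K))} =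
      AbelianVariety.Hom.kerRank (fibreHom φ (specGenericPoint R K)))
    {k : Type u} [Field k] (ψ : ResidueField R →+* k) (t₀ : Spec (CommRingCat.of k) ⟶ (GroupSchemeKernel.ker φ).left)
    (ht₀ : t₀ ≫ (GroupSchemeKernel.ker φ).hom = Spec.map (CommRingCat.ofHom (ψ.comp (residue R)))) :
    ∃ s : 𝟙_ (Over (Spec (CommRingCat.of R))) ⟶ GroupSchemeKernel.ker φ,
      Spec.map (CommRingCat.ofHom (ψ.comp (residue R))) ≫ s.left = t₀ := by
  haveI := isFinite_ker_hom K φ hφ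
  haveI := flat_ker_hom K φ hφ
  have hcard : Nat.card (𝟙_ (Over (Spec (CommRingCat.of R))) ⟶ GroupSchemeKernel.ker φ) = Module.finrank R B' := by
    rw [natCard_sections_ker_eq_natCard_points K φ hφ, hK, finrank_presentation_eq_kerRank K φ hφ B' eB heB]
  exact exists_section_comp_eq_of_card_sections_eq_finrank (GroupSchemeKernel.ker φ) B' eB heB hcard ψ t₀ ht₀

end AbelianSchemeOver

end Literature.AlgebraicGeometry.AbelianSchemes

end
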